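import Literature.NumberTheory.EllipticCurves.CastellaHsieh2018.BranchBDPLFunctionExistence
import Literature.NumberTheory.GaloisRepresentations.GenusHeckeCharacter
import Literature.NumberTheory.EllipticCurves.HeegnerPointsOfConductor
import Literature.NumberTheory.EllipticCurves.PadicLogFiniteExtension
import HarnessLib

/-!
# Castella–Hsieh 2018, Lemma 5.4 + Thm. 5.7 (with Thm. 5.1 and the constant of Thm. 4.8): the VALUE
# of the `χ_ε`-branch of the BDP `p`-adic `L`-function at the genus character — `p · L(𝟙)` is a
# `p`-adic UNIT times the square of `log_{ω_E}` of the genus-twisted Heegner point of conductor `p`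

F. Castella, M.-L. Hsieh, *Heegner cycles and p-adic L-functions*, Math. Ann. **370** (2018)
567–628 = arXiv:1505.08165v1 (held `paper:arxiv-1505.08165`; v1 TeX pages `pNNNN:L` are quoted,
journal numbering in brackets where it differs). Cite item `wi-73260` (cell `bsd-schneider-ideate`,
crux r3 `GordTwoBranchIMC` = `stmt-BirchSwinnertonDyer-19177`, layer-2 input H2; consumer predicates
`KYRead.KYReadCHValue` / `KYRead.KYReadCHValueUnit` in
`Summits/…/Theorems/SchneiderFreeAdditiveX3[Upper]KYReadHypsBranch.lean`). Companion of
`BranchBDPLFunctionExistence.lean` (`castellaHsieh2018_exists_isBranchBDPLFunction`, Def. 3.7 +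
Prop. 3.8: the branch frame EXISTS); this file adds the value of that frame at `T = 0`.
ONE named fact; no `sorry`, no instance, no notation. Page sheet with every locator below:
`run/shared/lean/pub/bsd-stepL/audit/CH18-VALUE-N1-COFACTOR-lit-g17.md` (seat `bsd-stepL-lit` g17).

## What is printed (verbatim) and how the statement is assembled from it

* Standing hypotheses. p. 3: "Let `f ∈ S_{2r}^{new}(Γ₀(N))` be a newform of weight `2r` and level `N`.
  Fix an odd prime `p ∤ N`. … Let `K/ℚ` be an imaginary quadratic field of odd discriminant";
  "Hypothesis (H). The following hypotheses are assumed throughout. (a) `p ∤ 2(2r−1)!Nφ(N)`;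
  (b) the conductor of `χ` is prime to `N`; (c) `N` is a product of primes split in `K`;
  (d) `p = 𝔭𝔭̄` is split in `K`, where `𝔭` is induced by `ı_p`" — (a) is RE-IMPOSED in §4.2 (p. 12:
  "Let `p` be a prime with `p ∤ 2(2r−1)!Nφ(N)`") where the classes `z_{f,𝔞}` below are defined, so at
  weight `2` (`r = 1`) the value formula is printed under `p ∤ 2Nφ(N)`: the binder
  `¬ p ∣ Nat.totient N` is carried (whether the proofs of §5 use it is not decided here; `φ(N)`
  occurs in the paper only in the three hypothesis lists — lit sheets `PHIN-FREE-CHAIN-lit-g18.md`,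
  `L39-lit-g20.md` §1; the consumer cell types an OFF-scope socket for `p ∣ φ(N′)`,
  `KYRead.KYReadCHValueUnitOffScope`).
  §5.2 (p. 17): "we further assume that `p = 𝔭𝔭̄` splits in `K` and that the newform `f` is ordinary
  at `p`, the `p`-th Fourier coefficient `a_p(f) ∈ 𝒪_F^×`" — binder `¬ (p : ℤ) ∣ a_p(W)`.
  The character `ψ`. Thm. 5.7 (p. 19) / Thm. 4.8 (p. 15) are stated for "an anticyclotomic Hecke
  character `ψ` of infinity type `(r,−r)` and conductor `c_o𝒪_K` with `(c_o, Np) = 1`" (also §4.4, p. 15;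
  used p. 16, p. 18, p. 19); the frame family of this file forces `c_o = 1`, and at `r = 1` a Hecke
  character of `K` of infinity type `(1,−1)` and conductor `1` exists iff it is trivial on `𝒪_K^×`,
  i.e. iff `w_K = #𝒪_K^× = 2`, i.e. iff `d_K ∉ {−3, −4}` — binder `NumberField.discr K ≠ -3`
  (`−4` is excluded by the oddness binder). This binder was ABSENT from the first landed version
  (p507031, stronger than print on `ℚ(√−3)`); inserted per ARM-P D-audit r08 Q56 F-V1 /
  director-bsd DD-143 (sheet `pub/bsd-cited/sheets/D-AUDIT-r08-Q56-CH18condP.md`, kit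
  `d_audit_r08_Q56_ch18p_fix_consumers.lean` K5 = the exact bytes).
* The classes. §4.2/4.4 and (p. 15) "Define the generalized Heegner class `z_{f,χ}` attached to
  `(f, χ)` by `z_{f,χ} := cor_{K_{c_o p^s}/K}(z_{f,χ,c_o p^s}) = Σ_{σ ∈ Gal(K_{c_o p^s}/K)} χ_t(σ) ·
  (id ⊗ e_χ) z^σ_{f,c_o p^s}`", `c_o p^s 𝒪_K` the conductor of `χ`; at weight `2` (`r₁ = r − 1 = 0`,
  `S^{r₁} = ` trivial) `z_{f,c}` is the Abel–Jacobi/Kummer image of the Heegner point `x_c ∈ X₀(N)(K_c)`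
  of conductor `c` (§2.3–2.4, §4.1) — DICTIONARY FLAG (d1) below.
* **Lemma 5.4** (p. 17): "Suppose that `p ∤ c`. Let `χ : Gal(K_{cp^∞}/K_c) → 𝒪_{ℂ_p}^×` be a finite
  order character of conductor `cp^n` (`n > 0`) … Then `𝐳^χ_{f,c,α} = α^{−n} · z_{f,χ,c}`."
* **Theorem 5.1** (p. 17, the Loeffler–Zerbes big logarithm `ℒ_V`, "conductor `p^n`", every `n`) and
  its `ε`-factor (p. 19): "the `ε`-factor for the Galois character `φ̂_𝔭` defined in [LZ2] agrees with
  Tate's `ε`-factor for `φ_𝔭`, `ε(φ̂_𝔭) = ε(0, φ_𝔭) = 𝔤(φ_𝔭^{−1})φ_𝔭(−p^n)`", with the plain Gauss sum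
  (p. 4) "`𝔤(φ) = Σ_{u ∈ (ℤ/q^nℤ)^×} φ(u) ζ_{p^n}^u`".
* **Theorem 5.7** (p. 19): "Assume that `p = 𝔭𝔭̄` splits in `K`. Let `f ∈ S_{2r}^{new}(Γ₀(N))` with
  `p ∤ N` be a `p`-ordinary newform, and let `ψ` be an anticyclotomic Hecke character of infinity type
  `(r,−r)` and conductor `c_o𝒪_K`. Then `⟨𝓛_{𝔭,ψ}(𝐳_f), ω_f ⊗ t^{1−2r}⟩ = (−c_o^{r−1}) · ℒ_{𝔭,ψ}(f) ·
  σ_{−1,𝔭} ∈ Λ_{F̂^{ur}}(Γ̃)`" — an identity of INTEGRAL measures (p. 11: "We shall also view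
  `ℒ_{𝔭,ψ}(f)` as an element in the semi-local ring `𝒲⟦Γ̃⟧`"), proved by density from the characters
  of conductor `p^n`, `n > 1` (proof, first line), at which (eq:bdp) = Thm. 4.8 (`j = 0`) reads
  "`ℒ_{𝔭,ψ}(f)(φ̂^{−1}) = 𝔤(φ_𝔭^{−1})φ_𝔭(p^n)c_o^{−r₁}ψ̂_𝔭^{−1}(p^n)/r₁! · ⟨log_𝔭(z_{χ,f}), ω_f ⊗ t^{−r₁}⟩`",
  `χ := ψ̂^{−1}φ̂`; and (eq:LZ) (from Thm. 5.1, ANY conductor `p^n`, `n ≥ 1`) reads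
  "`⟨𝓛_{𝔭,ψ}(𝐳_f), ω_f⊗t^{1−2r}⟩(φ̂^{−1}) = −φ̂(σ_{−1,𝔭})α^n · 𝔤(φ_𝔭^{−1})φ_𝔭(p^n)ψ̂_𝔭^{−1}(p^n)/r₁! ·
  ⟨log_𝔭(𝐳_f^χ)⊗t^r, ω_f⊗t^{1−2r}⟩`". EVALUATING Thm. 5.7 at a character of conductor `p` (`n = 1`)
  through (eq:LZ) and Lemma 5.4 (`n = 1 > 0`; `α` the unit root, `φ̂(σ_{−1,𝔭})² = 1`) gives the
  `n = 1` case of the displayed formula (this is the route the cell's item text prescribes; Thm. 4.8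
  itself needs `n ≥ 2`).
* **The constant** — printed in the last display of the proof of Thm. 4.8 (p. 16, first equality):
  "`= 𝔤(ξ_𝔭^{−1}) c_o^{−r₁} p^{−nr} χ_𝔭(p^n)/(r₁+j)! · Σ… = 𝔤(φ_𝔭^{−1})φ_𝔭(p^n)c_o^{−r₁}ψ̂_𝔭^{−1}(p^n)/(r₁+j)!
  · Σ…`", i.e. `𝔤(φ_𝔭^{−1})·φ_𝔭(p^n)·ψ̂_𝔭^{−1}(p^n) = 𝔤(ξ_𝔭^{−1})·p^{−nr}·χ_𝔭(p^n)` with `χ_𝔭(p^n) =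
  χ(rec_𝔭(p^n))` the value of the GALOIS character `χ : Gal(K_{c_o p^∞}/K) → 𝒪_F^×` (§4.4), a unit
  (`φ_𝔭(p^n)` is the `𝔭`-component of the HECKE character `φ` of infinity type `(r,−r)`, of valuation
  `−nr` by the avatar formula of §3.3 "`χ̂(z) = i_p∘i_∞^{−1}(χ(z)) z_𝔭^m z_𝔭̄^n`"; `ψ̂_𝔭^{−1}(p^n)` is an
  avatar value, a unit). So at weight `2`, `c_o = 1`, `n = 1`, `χ` the quadratic genus character:
  `ℒ = p^{−1}·𝔤(χ_𝔭)·χ_𝔭(p)·⟨log_𝔭 z_{f,χ}, ω_f⟩` and, since `𝔤(χ_𝔭)² = χ_𝔭(−1)·p` and `χ_𝔭(p)² = 1`,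
  **`ℒ² = (p*)^{−1} · ⟨log_𝔭 z_{f,χ}, ω_f⟩²`**, `p* = χ_𝔭(−1)p = (−1)^{(p−1)/2} p`: the printed cofactor
  of the square of the UNDESCENDED logarithm has `p`-adic valuation `−1`.
* **The frame and its constants** (how `L ∈ R₀⟦T⟧` of the tree relates to `ℒ²`). The tree's
  `IsBranchBDPLFunction ι 𝔭 κ γ f χ e Ω_K Ω_p L` (file `BDPBranchPAdicLFunction`) is Castella's
  reformulation (Castella 2018 Thm. 3.1) of Prop. 3.6 [3.8] on the `χ`-branch: at every character
  `χφ` of the interpolation range `L(φ̂(γ)−1) = ι^{−1}(Γ(n)Γ(n+1)·e·φ(𝔭)^{−2}·L(f/K,χφ,1)/(π^{2n+1}Ω_K^{4n}))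
  ·Ω_p^{4n}`, while Prop. 3.6 [3.8] gives `(ℒ(φ̂)/Ω_p^{2r+2m})² = L^{alg}·e_𝔭·φ(𝔑^{−1})·2^{#A(ψ)+3}c_o
  ε(f)·u_K²√D_K` with `(4π)^{2n+1}(Im ϑ)^{2n}` inside `L^{alg}`. The `n`-dependent factors `16^n`,
  `(Im ϑ)^{2n}` are absorbed in `Ω_K^{4n}`; `(χφ)(𝔑^{−1}) = χ(𝔑^{−1})·φ̂(σ_𝔑)^{−1}` is `±(1+T)^{s_𝔑}`
  evaluated at `T_φ` (`φ̂` factors through `κ`); `e_𝔭(f, χφ) = ε(½,χ_𝔭)^{−2}φ_𝔭(p)^{−2}` is the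
  predicate's `e·φ(𝔭)^{−2}` (Tate's unramified-twist rule). Hence the TRUE frame is
  `L = A·(1+T)^{s}·Tw(ℒ)²` with `A = ι^{−1}(4·2³·ε(f)·u_K²·√D_K·χ(𝔑^{−1})·ε(½,χ_𝔭)^{∓2})^{±1}` a
  `p`-adic UNIT for `p` odd and split in `K` of odd discriminant (`p ∤ 2D_K`; `p ∤ u_K`, since
  `u_K ≠ 1` only for `d_K ∈ {−3, −4}`, where an odd split `p` is impossible resp. `d_K` is even;
  `A(ψ) = ∅` under (Heeg); `c_o = 1`; `ε(½,χ_𝔭)² = χ_𝔭(−1)`), `Ω_p ∈ 𝒲^×` (§2.5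
  "`(Ω_K, Ω_p) ∈ ℂ^× × 𝒲^×`"), and at `T = 0` — the finite-order point `χ = χ_ε` itself —
  **`L(0) = A·ℒ² = (unit)·p^{−1}·⟨log_𝔭 z_{f,χ}, ω_f⟩²`**. With the dictionary (d2) `⟨log_𝔭(·), ω_f⟩ =
  log_{ω_W}(·)/c` (`c` the Manin constant of the parametrisation datum: `φ^*ω_W = c·2πi f dτ`), this is
  the displayed conclusion `L.HasValueAt 0 (u · p^{−1} · (log_{ω_W}(z)/c)²)`, `u ∈ R₀^×`.

## Dictionary flags (what is transcription, not print) and the descended reading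

(d1) weight-2 class = Kummer image of the Heegner POINT: `z_{f,χ} ↔ z := Σ_{τ ∈ Gal(K[p]/K)} χ_ε(τ)·
y(p)^τ ∈ W(K[p])`, `y(p) = φ(x(p))` the Heegner point of conductor `p` of the datum `Dt` at an
orientation `β` (`heegnerPointComplexOfConductor Dt d_K β p`; the choice of `x(p)` in its
`Gal(K[p]/K)`-orbit or of `β ↦ −β` changes `z` by a sign / by Lemma 4.6, invisible in the square).
(d2) `⟨log_𝔭(z_{f,χ}), ω_f⟩ = log_{ω_W}(z)/c` read in `ℂ_p` through an embedding `j : K[p] → ℂ_p`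
above `𝔭` (`FormalGroupChart.padicLogPointFiniteExt` of the definition item `defn-padicLogPointFiniteExt`,
`ω_W` the differential of the model `W` — take `W` minimal; `j` above `𝔭` ⇔ `‖j k‖ < 1 ↔ k ∈ 𝔭`;
another embedding above `𝔭` changes `z ↦ χ_ε(σ) z`, invisible in the square). (d3) the genus character
on the Galois side is the SIGN COCYCLE `s` of `θ = √p*` (`τθ = s(τ)θ`; `K(θ) ⊂ K[p]` is cut out by
`χ_ε`), so no reciprocity map is needed; on the Hecke side it is `genusHeckeCharacter K p = ε_p ∘ N_{K/ℚ}`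
(file `GaloisRepresentations/GenusHeckeCharacter`; `rfl`-equal to `KellerYin2024.genusHeckeCharacter`).
(d4) `L ↔ ℒ²` through Castella's reformulation, as for `IsBDPLFunction`/`IsBranchBDPLFunction`.
DESCENT (for the consumer, not asserted here): `z` is `χ_ε`-isotypic, so `log_{ω_W}(z)` lies in the
`χ_ε|_{D_𝔭}`-eigenline `θ·ℚ_p` of `K[p]_𝔓`; the twisting isomorphism `Φ : W → W^{(p*)}`,
`(x,y) ↦ (θ²x, θ³y)`, has `Φ^*ω_{W^{(p*)}} = θ^{−1}ω_W`, so the descended `K`-point `Q = Φ(z)` has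
`log_{ω_{W^{(p*)}}}(Q) = θ^{−1}·log_{ω_W}(z)` and `p^{−1}·log_{ω_W}(z)² = (p*/p)·log(Q)² = ±log(Q)²`:
in the DESCENDED currency of `KYRead.KYReadCHValueUnit` the cofactor is a unit (and a fortiori integral,
`KYRead.KYReadCHValue`).

## Scope / what is NOT claimed

The sign inside `u`; the Manin-constant/modular-degree dictionary beyond (d2) (the hypothesis
`p ∤ c` is NOT needed: `c` is divided out exactly); whether §5's proofs use (H)(a); anything for
`p ∣ N`, `p = 2`, `p` inert, non-quadratic branch characters (there `v_p(𝔤)` is fractional and no descent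
to `K` exists); the `∀ μ = 0 frame` formulation of the door (it needs Keller–Yin 2024b Thm. 3.5.1,
a preprint — kept on the Summits side). An alternative printed source WITHOUT (H)(a) but with
`p ∤ h_K` and `ρ̄_f|_{G_K}` absolutely irreducible is Castella, JIMJ 19 (2020) = arXiv:1410.6591, Thm. A /
Thm. 2.5 (same `ε(φ)^{−1}` constant); not used here.

* `castellaHsieh2018_branchValue_conductorP` — the named fact (ONE `def … : Prop`).
* `castellaHsieh2018_branchValue_conductorP.exists_isBranchBDPLFunction` — forgetting the value:
  the fact yields a branch frame for `(Dt.f, χ_ε)` (the shape of the sibling's conclusion), PROVED.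
* `branchValueShape_ne_zero` — `u · p⁻¹ · x² ≠ 0` for a unit `u` and `x ≠ 0`, PROVED (the
  non-vanishing clause consumers pair with `padicLogPointFiniteExt_eq_zero_iff`); private plumbing
  `coe_units_unrIntegers_ne_zero` (a unit of `R₀` is non-zero in `ℂ_p`).

References: [CastellaHsieh2018] Hypothesis (H) (v1 p. 3), §3.3 (avatar, `e_𝔭`, v1 pp. 9–10),
Def. 3.5/Prop. 3.6 [3.7/3.8] (v1 p. 11), §4.2 (v1 p. 12), Thm. 4.8 and its proof (v1 pp. 15–16),
Thm. 5.1, §5.2, Lemma 5.4 (v1 p. 17), Thm. 5.7 with (eq:bdp)/(eq:LZ) (v1 p. 19); [Castella2018] Thm. 3.1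
(arXiv:1704.06608 p. 9, the normalisation); [KellerYin2024b] §3.4 (arXiv:2410.23241 p. 19: the name
`ℒ_ε` only; preprint); [SilvermanAEC2009] III.1 Table 3.1 (`u^{−1}ω' = ω` under a change of
variables — the descent remark), IV.6/VII.2.2 (`log_ω`).
-/

noncomputable section

open scoped Classical

open NumberField IsDedekindDomain Field Literature.NumberTheory.EllipticCurves.ModularForms
open Literature.NumberTheory.GaloisRepresentations

namespace Literature.NumberTheory.EllipticCurves

section Fact

/-- **Castella–Hsieh 2018, Lemma 5.4 + Thm. 5.7 (with Thm. 5.1 and the constant of the proof of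
Thm. 4.8): the value at the genus character of the `χ_ε`-branch of the BDP `p`-adic `L`-function of
an elliptic curve** — named fact, weight `2`, branch character `χ_ε = genusHeckeCharacter K p`, in
the currency of `IsBranchBDPLFunction` and of the `ℂ_p`-valued logarithm `padicLogPointFiniteExt`.
HYPOTHESES (verbatim Castella–Hsieh p. 3, (H), §4.1, §5.2, plus the frame binders of the sibling
`castellaHsieh2018_exists_isBranchBDPLFunction`): `W/ℚ` elliptic with parametrisation datum `Dt` at
level `N` (`Dt.f` its newform, `Dt.c` the Manin constant of `Dt.φ`), `p` an ODD prime with `p ∤ N`,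
`p ∤ φ(N)` ((H)(a) at `r = 1`), `f` ORDINARY at `p` (`p ∤ a_p(W)`), `K` imaginary quadratic of ODD
discriminant `d_K ≠ −3` (ψ: Thm. 5.7/4.8 take an anticyclotomic `ψ` of infinity type `(1,−1)` with
conductor `c_o` prime to `Np`; the frame family forces `c_o = 1`, and an everywhere-unramified such `ψ`
exists iff `w_K = 2`, i.e. `d_K ∉ {−3,−4}` — `−4` is already excluded by oddness),
`p = 𝔭𝔭̄` SPLIT with `𝔭` the prime singled out by `ι : ℚ̄_p ≃ ℂ`, (Heeg) for `N`,
an orientation `β` (`4N ∣ β² − d_K`), `κ` THE anticyclotomic `ℤ_p`-extension with topological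
generator `γ`. CONCLUSION: there are a branch constant `e ≠ 0`, CM periods `Ω_K ≠ 0`, `Ω_p ∈ R₀^×`,
a frame `L ∈ R₀⟦T⟧` with `IsBranchBDPLFunction ι 𝔭 κ γ Dt.f χ_ε e Ω_K Ω_p L`, AND a unit `u ∈ R₀^×`
such that for every lift `y ∈ W(K[p])` of the Heegner point `y(p) = Dt.φ(x(p))` of conductor `p`,
every square root `θ` of `p* = (−1)^{(p−1)/2}p` in `K[p]` with its sign cocycle `s` (`τθ = s(τ)θ` —
the genus character on `Gal(K[p]/K)`), and every embedding `j : K[p] → ℂ_p` above `𝔭`: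
  `L(0) = u · p^{−1} · (log_{ω_W}(Σ_τ s(τ)·τy)/c)²`,
the logarithm read in `ℂ_p` along `j` (`padicLogPointFiniteExt ‖·‖ (W ⊗ ℂ_p) p`). IN PRINT: Thm. 5.7's
identity evaluated at the conductor-`p` point through Thm. 5.1 and Lemma 5.4 gives
`ℒ_{𝔭,ψ}(f)(φ̂^{−1}) = 𝔤(φ_𝔭^{−1})φ_𝔭(p)ψ̂_𝔭^{−1}(p)·⟨log_𝔭 z_{f,χ}, ω_f⟩` and the proof of Thm. 4.8
(p. 16) prints `𝔤(φ_𝔭^{−1})φ_𝔭(p^n)ψ̂_𝔭^{−1}(p^n) = 𝔤(ξ_𝔭^{−1})p^{−nr}χ_𝔭(p^n)`; with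
`𝔤(χ_𝔭)² = χ_𝔭(−1)p` this is `ℒ² = (p*)^{−1}⟨log_𝔭 z_{f,χ}, ω_f⟩²`, and `L(0) = A·ℒ²` with the
reformulation constant `A` a `p`-adic unit — see the module docstring for the bookkeeping, the
dictionary flags (d1)–(d4) and the descended (unit-cofactor) reading used by the door.
VERBATIM-COMPOSITE of published statements; nothing on the sign in `u`.
[cite: CastellaHsieh2018, Thm. 5.7, Lemma 5.4, Thm. 5.1 and the proof of Thm. 4.8 (arXiv:1505.08165v1 pp. 15–19), with Hypothesis (H) (p. 3), §4.2 (p. 12), §5.2 (p. 17), Def. 3.5/Prop. 3.6 = journal Def. 3.7/Prop. 3.8 (p. 11)]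
[cite: Castella2018, Thm. 3.1 (arXiv:1704.06608 p. 9), the normalisation of the frame]
[cite: KellerYin2024b, §3.4 (arXiv:2410.23241 p. 19), the name `ℒ_ε` only (preprint)] -/
def castellaHsieh2018_branchValue_conductorP : Prop :=
  ∀ {p : ℕ} [Fact p.Prime] (ι : PadicAlgCl p ≃+* ℂ) (W : WeierstrassCurve ℚ) [W.IsElliptic]
    [W.IsGloballyMinimal] (K : Type) [Field K] [NumberField K] [IsGalois ℚ K] (ι₀ : K →+* ℂ)
    (𝔭 : HeightOneSpectrum (𝓞 K)) (κ : ZpExtension K p) (γ : absoluteGaloisGroup K) {N : ℕ}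
    [NeZero N] (Dt : ModularParametrizationData W N) (β : ℤ),
    p ≠ 2 → ¬ p ∣ N → ¬ p ∣ Nat.totient N → ¬ (p : ℤ) ∣ W.LFunction p →
    IsImaginaryQuadratic K → Odd (NumberField.discr K) → NumberField.discr K ≠ -3 →
    ((Ideal.span {(p : ℤ)}).primesOver (𝓞 K)).ncard = 2 →
    ((p : ℕ) : 𝓞 K) ∈ 𝔭.asIdeal →
    (∀ (w : InfinitePlace K) (k : 𝓞 K),
      k ∈ 𝔭.asIdeal ↔ ‖ι.symm (w.embedding (k : K))‖ < 1) →
    SatisfiesHeegnerHypothesis N K → (4 * (N : ℤ)) ∣ β ^ 2 - NumberField.discr K →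
    κ.IsAnticyclotomic → κ.IsTopGenerator γ →
    ∃ (e : ℂ) (ΩK : ℂ) (Ωp : (unrIntegers p)ˣ) (L : UnrSeries p),
      e ≠ 0 ∧ ΩK ≠ 0 ∧
      IsBranchBDPLFunction ι 𝔭 κ γ Dt.f (genusHeckeCharacter K p) e ΩK
        ((Ωp : unrIntegers p) : ℂ_[p]) L ∧
      ∃ u : (unrIntegers p)ˣ,
        ∀ [NumberField (ringClassField K ι₀ p)]
          [(W.baseChange ℂ_[p]).IsIntegral (NormedField.valuation (K := ℂ_[p])).integer]
          (y : (W.baseChange (ringClassField K ι₀ p : Type)).toAffine.Point),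
          WeierstrassCurve.Affine.Point.map (ringClassField K ι₀ p).subtype.toRatAlgHom y =
            heegnerPointComplexOfConductor Dt (NumberField.discr K) β p →
          ∀ (θ : ringClassField K ι₀ p),
            θ ^ 2 = algebraMap ℚ (ringClassField K ι₀ p) ((-1 : ℚ) ^ (p / 2) * p) →
          ∀ (s : ringClassGal ι₀ p → ℤˣ),
            (∀ σ : ringClassGal ι₀ p, σ.1 θ = ((s σ : ℤ) : ringClassField K ι₀ p) * θ) →
          ∀ (j : ringClassField K ι₀ p →+* ℂ_[p]),
            (∀ k : 𝓞 K, k ∈ 𝔭.asIdeal ↔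
              ‖j (algebraMap K (ringClassField K ι₀ p) (k : K))‖ < 1) →
            L.HasValueAt 0
              (((u : unrIntegers p) : ℂ_[p]) * ((p : ℂ_[p]))⁻¹ *
                (FormalGroupChart.padicLogPointFiniteExt (NormedField.valuation (K := ℂ_[p]))
                    (W.baseChange ℂ_[p]) p
                    (WeierstrassCurve.Affine.Point.map j.toRatAlgHom
                      (∑ τ : ringClassGal ι₀ p,
                        (s τ : ℤ) • pointGalHom W (ringClassField K ι₀ p : Type) τ.1 y)) /
                  (Dt.c : ℂ_[p])) ^ 2)

end Fact

/-! ### API (proved) -/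

section API

variable {p : ℕ} [Fact p.Prime]

/-- **The fact yields a branch frame for `(Dt.f, χ_ε)`** on its domain (forget the value clause) —
the shape of the conclusion of the sibling `castellaHsieh2018_exists_isBranchBDPLFunction`, here
without the three branch-character hypotheses (they are theorems for `χ_ε`:
`genusHeckeCharacter_sq`, `_isUnramifiedAt`, `genusHeckeCharacter_hasConductorExponentAt_one`).
[cite: CastellaHsieh2018, Def. 3.7 and Prop. 3.8 (arXiv:1505.08165v1 p. 11)] -/
theorem castellaHsieh2018_branchValue_conductorP.exists_isBranchBDPLFunction
    (h : castellaHsieh2018_branchValue_conductorP) (ι : PadicAlgCl p ≃+* ℂ)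
    (W : WeierstrassCurve ℚ) [W.IsElliptic] [W.IsGloballyMinimal] (K : Type) [Field K]
    [NumberField K] [IsGalois ℚ K] (ι₀ : K →+* ℂ) (𝔭 : HeightOneSpectrum (𝓞 K))
    (κ : ZpExtension K p) (γ : absoluteGaloisGroup K) {N : ℕ} [NeZero N]
    (Dt : ModularParametrizationData W N) (β : ℤ) (hp2 : p ≠ 2) (hpN : ¬ p ∣ N)
    (hφ : ¬ p ∣ Nat.totient N) (hord : ¬ (p : ℤ) ∣ W.LFunction p) (hK : IsImaginaryQuadratic K)
    (hodd : Odd (NumberField.discr K)) (hdK : NumberField.discr K ≠ -3)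
    (hsplit : ((Ideal.span {(p : ℤ)}).primesOver (𝓞 K)).ncard = 2)
    (h𝔭 : ((p : ℕ) : 𝓞 K) ∈ 𝔭.asIdeal)
    (hcompat : ∀ (w : InfinitePlace K) (k : 𝓞 K),
      k ∈ 𝔭.asIdeal ↔ ‖ι.symm (w.embedding (k : K))‖ < 1)
    (hHeeg : SatisfiesHeegnerHypothesis N K) (hβ : (4 * (N : ℤ)) ∣ β ^ 2 - NumberField.discr K)
    (hκ : κ.IsAnticyclotomic) (hγ : κ.IsTopGenerator γ) :
    ∃ (e : ℂ) (ΩK : ℂ) (Ωp : (unrIntegers p)ˣ) (L : UnrSeries p),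
      e ≠ 0 ∧ ΩK ≠ 0 ∧
      IsBranchBDPLFunction ι 𝔭 κ γ Dt.f (genusHeckeCharacter K p) e ΩK
        ((Ωp : unrIntegers p) : ℂ_[p]) L := by
  obtain ⟨e, ΩK, Ωp, L, he, hΩ, hL, -⟩ :=
    h ι W K ι₀ 𝔭 κ γ Dt β hp2 hpN hφ hord hK hodd hdK hsplit h𝔭 hcompat hHeeg hβ hκ hγ
  exact ⟨e, ΩK, Ωp, L, he, hΩ, hL⟩

/-- A unit of `R₀ = 𝒲` is non-zero in `ℂ_p` (plumbing). [folklore] -/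
private theorem coe_units_unrIntegers_ne_zero (u : (unrIntegers p)ˣ) :
    ((u : unrIntegers p) : ℂ_[p]) ≠ 0 := by
  intro h
  exact (Units.ne_zero u) (by exact_mod_cast h)

/-- **The value shape `u · p⁻¹ · x²` of Castella–Hsieh's formula is non-zero as soon as `x ≠ 0`**
(`u` a unit of `R₀`): the clause consumers combine with `padicLogPointFiniteExt_eq_zero_iff` (the
logarithm vanishes only at torsion points) to read `ℒ_{𝔭,ψ}(f)(χ̂) ≠ 0` off a non-torsion
genus-twisted Heegner point, as in the first bullet of Thm. 6.1 / the proof of Thm. A ("the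
nonvanishing of the value … translates into the nonvanishing of the natural image of `𝐳_f`").
[cite: CastellaHsieh2018, Thm. 5.7 with (eq:bdp) (arXiv:1505.08165v1 p. 19), the shape of the value] -/
theorem branchValueShape_ne_zero (u : (unrIntegers p)ˣ) {x : ℂ_[p]} (hx : x ≠ 0) :
    ((u : unrIntegers p) : ℂ_[p]) * ((p : ℂ_[p]))⁻¹ * x ^ 2 ≠ 0 := by
  have hp : (p : ℂ_[p]) ≠ 0 := Nat.cast_ne_zero.mpr (Fact.out : p.Prime).ne_zero
  exact mul_ne_zero (mul_ne_zero (coe_units_unrIntegers_ne_zero u) (inv_ne_zero hp))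
    (pow_ne_zero 2 hx)

/-- **Accessor in the PRINTED hypothesis list (ARM-P D-audit r08 Q56 F-V1 / director-bsd DD-143).**
Castella–Hsieh's Thm. 5.7 / Thm. 4.8 are stated for an anticyclotomic Hecke character `ψ` of infinity
type `(r,−r)` "and conductor `c_o𝒪_K` with `(c_o, Np) = 1`" (arXiv:1505.08165v1 p. 19, p. 15; §4.4);
the frame family of this file forces `c_o = 1`, and at weight `2` a Hecke character of `K` of infinity
type `(1,−1)` and conductor `1` exists iff it is trivial on `𝒪_K^×`, i.e. iff `w_K = 2`, i.e. iff
`d_K ∉ {−3, −4}` (`−4` is excluded by the oddness binder). This theorem states the value formula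
under the binder `NumberField.discr K ≠ -3`, in the exact binder order of the D-audit's kit
(`pub/bsd-cited/sheets/r08-Q56/kit/d_audit_r08_Q56_ch18p_fix_consumers.lean`, K5 `V_dKneThree`),
and is the form consumers should apply (the Summits consumer
`SchneiderFree.Upper.additiveIMCUpperBDPOnTreeLeAt_of_KY_branch_of_castellaHsiehValue` has `hdK` in
scope). (Since the in-place insertion of the binder into the named fact — DD-143 step 3 — this accessor is
the fact itself with named binders; it is kept because the Summits consumer applies it by name.)
[cite: CastellaHsieh2018, Thm. 5.7, Lemma 5.4, Thm. 5.1, proof of Thm. 4.8 and §4.4 (arXiv:1505.08165v1 pp. 15–19): "`ψ` … of infinity type `(r,−r)` and conductor `c_o𝒪_K` with `(c_o, Np) = 1`"] -/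
theorem castellaHsieh2018_branchValue_conductorP.hasValueAt
    (h : castellaHsieh2018_branchValue_conductorP) (ι : PadicAlgCl p ≃+* ℂ)
    (W : WeierstrassCurve ℚ) [W.IsElliptic] [W.IsGloballyMinimal] (K : Type) [Field K]
    [NumberField K] [IsGalois ℚ K] (ι₀ : K →+* ℂ) (𝔭 : HeightOneSpectrum (𝓞 K))
    (κ : ZpExtension K p) (γ : absoluteGaloisGroup K) {N : ℕ} [NeZero N]
    (Dt : ModularParametrizationData W N) (β : ℤ) (hp2 : p ≠ 2) (hpN : ¬ p ∣ N)
    (hφ : ¬ p ∣ Nat.totient N) (hord : ¬ (p : ℤ) ∣ W.LFunction p) (hK : IsImaginaryQuadratic K)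
    (hodd : Odd (NumberField.discr K)) (hdK : NumberField.discr K ≠ -3)
    (hsplit : ((Ideal.span {(p : ℤ)}).primesOver (𝓞 K)).ncard = 2)
    (h𝔭 : ((p : ℕ) : 𝓞 K) ∈ 𝔭.asIdeal)
    (hcompat : ∀ (w : InfinitePlace K) (k : 𝓞 K),
      k ∈ 𝔭.asIdeal ↔ ‖ι.symm (w.embedding (k : K))‖ < 1)
    (hHeeg : SatisfiesHeegnerHypothesis N K) (hβ : (4 * (N : ℤ)) ∣ β ^ 2 - NumberField.discr K)
    (hκ : κ.IsAnticyclotomic) (hγ : κ.IsTopGenerator γ) :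
    ∃ (e : ℂ) (ΩK : ℂ) (Ωp : (unrIntegers p)ˣ) (L : UnrSeries p),
      e ≠ 0 ∧ ΩK ≠ 0 ∧
      IsBranchBDPLFunction ι 𝔭 κ γ Dt.f (genusHeckeCharacter K p) e ΩK
        ((Ωp : unrIntegers p) : ℂ_[p]) L ∧
      ∃ u : (unrIntegers p)ˣ,
        ∀ [NumberField (ringClassField K ι₀ p)]
          [(W.baseChange ℂ_[p]).IsIntegral (NormedField.valuation (K := ℂ_[p])).integer]
          (y : (W.baseChange (ringClassField K ι₀ p : Type)).toAffine.Point),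
          WeierstrassCurve.Affine.Point.map (ringClassField K ι₀ p).subtype.toRatAlgHom y =
            heegnerPointComplexOfConductor Dt (NumberField.discr K) β p →
          ∀ (θ : ringClassField K ι₀ p),
            θ ^ 2 = algebraMap ℚ (ringClassField K ι₀ p) ((-1 : ℚ) ^ (p / 2) * p) →
          ∀ (s : ringClassGal ι₀ p → ℤˣ),
            (∀ σ : ringClassGal ι₀ p, σ.1 θ = ((s σ : ℤ) : ringClassField K ι₀ p) * θ) →
          ∀ (j : ringClassField K ι₀ p →+* ℂ_[p]),
            (∀ k : 𝓞 K, k ∈ 𝔭.asIdeal ↔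
              ‖j (algebraMap K (ringClassField K ι₀ p) (k : K))‖ < 1) →
            L.HasValueAt 0
              (((u : unrIntegers p) : ℂ_[p]) * ((p : ℂ_[p]))⁻¹ *
                (FormalGroupChart.padicLogPointFiniteExt (NormedField.valuation (K := ℂ_[p]))
                    (W.baseChange ℂ_[p]) p
                    (WeierstrassCurve.Affine.Point.map j.toRatAlgHom
                      (∑ τ : ringClassGal ι₀ p,
                        (s τ : ℤ) • pointGalHom W (ringClassField K ι₀ p : Type) τ.1 y)) /
                  (Dt.c : ℂ_[p])) ^ 2) :=
  h ι W K ι₀ 𝔭 κ γ Dt β hp2 hpN hφ hord hK hodd hdK hsplit h𝔭 hcompat hHeeg hβ hκ hγ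

end API

end Literature.NumberTheory.EllipticCurves

end
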